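import Summits.ResolutionOfSingularities.ResolutionOfSingularities.Theorems.DeltaCutMirror3
import HarnessLib

/-!
# SingCutCertificates — decomp-res lens-6 g30 node «SingCut»: THE LOCATED RESIDUAL KIND F-ss² IS INHABITED
# (T₃ = `z³ + (t·u·w)⁴`, char 3, S-FROZEN at s-height 0) and D′₃ = `z³ + u·t³w³` IS S-DECIDED at s-height 2
# (every chart, by the LANDED mirror certificates read as the singular run)

Companion of `SingCut.lean` (the law: the singular refined hop `sHop` — at a `SingFrozen` level blow up
`𝓘(closure Sing Σ_red)` of the surface part `Σ` of the bad closure, then the reduced strict transform of the OLD `Σ` — its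
run, letters, engine and cells).  Ring level only; format and dictionary of the column's certificate files
(`DeltaCutSepCertificates` … `DeltaCutMirror3`): (ord) `∃ s ∉ 𝔮, s·g ∈ 𝔮^m`; WILD = `3`-power form `z³ + r`, `r ∈ 𝔫⁴`;
NEAR = a chart origin of the point blow-up where the transform lies in `𝔫'³` for a generic cofactor; NO-TOP = `s·g ∈ 𝔮³ ⟹
False`; (L) Rees charts `linChartSubst A e` / `chartSubst e`; (R) coordinate linear subspaces and disjoint unions of them
are regular, a scheme whose local ring at a point is not a domain is not; (R″) a complete intersection `V(f₁, f₂)` with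
`f₂ ∈ 𝔭²` is SINGULAR at `𝔭`.  Coordinates `0 = z, 1 = t, 2 = u, 3 = w`.

## §SCertificatesA — T₃ = `z³ + (t·u·w)⁴` (char 3): THE F-ss² CERTIFICATE (`SFrozen 3 ⟨(𝔸⁴,(T₃)), none⟩` at s-height 0)

(T) a prime of order `≥ 3` contains `z` and one of `t, u, w` (`∂_t T₃ = 4·u·w·(tuw)³`; `T3_top`): top `⊆ P_t ∪ P_u ∪ P_w`,
the three coordinate planes of `V(z)`; (W) each plane lies in the top locus, is a plane, and the datum is WILD along it
(`T₃ ∈ (z,x)³`, `(tuw)⁴ ∈ (z,x)⁴`; `T3_wild_plane`, `X_not_mem_span_pair`); (N) EVERY closed point `(0,0,a,b)` of `P_t` (and of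
`P_u`, `P_w` by the symmetry `T3_symm`) has a NEAR point: chart `u` of the point blow-up gives `u³·(z'³ + u·t'⁴·Φ)` and
`z'³ + u·t'⁴·Φ ∈ 𝔫'³` for every cofactor (`T3_near`) — bad₀ = ALL closed points of the three planes, closure bad₀ `= P_t ∪ P_u
∪ P_w = Σ` (its own surface part), NONEMPTY; (R′) `Σ` is NOT regular (`t·(uw) ∈ J`, `t, uw ∉ J`, `J = 𝓘(P_t) ∩ 𝓘(P_u) ∩
𝓘(P_w)`; `T3_closure_not_prime`) and NOT a curve (it contains the plane `P_t`): separating, curve and surface-part tests FAIL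
— graded-STUCK (g28's reading); (S′) NEW: `Sing(Σ_red)` = THE THREE COORDINATE AXES `A_t ∪ A_u ∪ A_w` of `V(z)` — `Σ =
V(z, tuw)` is a complete intersection with `tuw ∈ (u,w)² ∩ (t,w)² ∩ (t,u)²` (singular along each axis, (R″)) and equal to a
coordinate plane on `D(uw) ∪ D(tw) ∪ D(tu)` = off the axes (`T3_sing_axes`) — and the reduced closure of the three
concurrent axes is NOT REGULAR at the origin (`t·u ∈ I_A`, `t, u ∉ I_A`; `T3_singClosure_not_prime`): the g30 test
`SingRegular` FAILS too — the singular run is STUCK at level `0` with a nonempty bad locus: `SFrozen` with the empty moving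
prefix (`SingCut.sStuck_iff_singSing`), conjunction `T3_sFrozen_certificate`.  (T₃ is the natural third member of the
series `Cx = z³ + s·u²w` (two lines through a point, g26) → D′ = `z³ + u·t³w³` (two planes through a line, g29) → T₃ (three
planes through three concurrent lines).)

## §SCertificatesB — D′₃ = `z³ + u·t³·w³` (char 3) IS S-DECIDED at s-height 2 (the eliminated sub-kind «F-surf-sing with
REGULAR Sing-closure» INHABITED and DECIDED; every chart LANDED)

The singular run of D′₃ IS the «memory composite» certified chart by chart in the landed g29 files, READ AS `sRun`:
level 0 is `SingFrozen` — graded-stuck (`Dm_gFrozen_certificate`) AND `Sing(Σ_red) = L = V(z,t,w)` exactly (`Σ = P_t ∪ P_w =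
V(z, tw)`: `tw ∈ (t,w)²` — singular along `L`, (R″) —, `= (z,t)` on `D(w)` and `= (z,w)` on `D(t)` — regular off `L` —;
`Dm_singNow_reading`), whose reduced closure `L` is a coordinate LINE: REGULAR, nonempty (R) — the singular hop FIRES;
STEP 1 = the blow-up of `L` (`mirrorF_lineChart_t/_w`: charts `t`, `w` return D′₃ with exceptional plane `V(z,t)` resp.
`V(z,w)` and OLD plane `V(z,w)` resp. `V(z,t)`; chart `z`: no top, `Dm_lineChart_z_noTop`); STEP 2 = the blow-up of the
strict transform `P̃_t ⊔ P̃_w` of the OLD surface part (two DISJOINT coordinate planes, one per chart: `OldSurfRegular` (R);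
`mirrorF_oldPlaneChart_w`: `F₂ = z³ + u·t³`, `mirrorF_oldPlaneChart_z`: no top); LEVEL 1: top `=` bad closure `=` the
REGULAR exceptional plane `V(z,t)` (`planeF_top`, `planeF_plane_bad`): `SepActive` — the singular hop IS g26's separating
hop there (`sHop_eq_gHop`, `gHop_eq_refHop`): blow up `V(z,t)` (`planeF_newPlaneChart_t`: `z³ + u`, order `≤ 1`;
`planeF_newPlaneChart_z`: no top; its step 2 has EMPTY centre: no old top component is left); LEVEL 2: NO top point
anywhere (`Dm_memory_noTop`) — `BadEmpty`: `STerminates` at s-height `2` (conjunction `Dm_sDecided_certificate`).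

Provenance: HOME = run/shared/lean/pub/decomp-res, lens-6 g30; imports the LANDED `Theorems.DeltaCutMirror3` (hence
`DeltaCutMirror1/2`, `DeltaCutGradeCertificates3`, `DeltaCutSepCertificates*`, `DeltaCutChainCertificates`: `pow_not_mem`,
`sq_mul_deriv_mem_pow`, `mem_of_mul_mul_pow_mem_pow`, `mem_of_sMul_mem_cube`, `natCast_not_mem`, `not_mem_span_of_eval`,
`X_mem_spanX4`, `f_self`, `f_ne`, `chartSubst`, `linChartSubst`, `mirrorF`) + `HarnessLib`; namespace
`…Theorems.DeltaCutClasses`, NEW sections `SCertificatesA`, `SCertificatesB`; nothing vendored, every declaration new.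
-/


noncomputable section

open CategoryTheory CategoryTheory.Limits AlgebraicGeometry TopologicalSpace IsLocalRing
open Literature.AlgebraicGeometry.Resolution

universe u

namespace Summit.ResolutionOfSingularities.ResolutionOfSingularities.Theorems.DeltaCutClasses

open Summit.ResolutionOfSingularities.ResolutionOfSingularities.Theorems.TwistCutClasses
open Summit.ResolutionOfSingularities.ResolutionOfSingularities.Theorems.LightCutClasses

section SCertificatesA

open MvPolynomial
variable {K : Type*} [Field K]

/-! #### §A — T₃ = `z³ + (t·u·w)⁴` (char 3): the located residual kind F-ss² is inhabited -/

/-- a coordinate off a coordinate pair is not in the ideal the pair spans (evaluation at the corresponding unit vector).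
[elementary] [folklore] -/
theorem X_not_mem_span_pair {i j : Fin 4} (hj0 : j ≠ 0) (hji : j ≠ i) :
    (X j : MvPolynomial (Fin 4) K) ∉ Ideal.span {(X 0 : MvPolynomial (Fin 4) K), X i} := by
  refine not_mem_span_of_eval _ (fun l => if l = j then 1 else 0) ?_ (by simp)
  intro g hg
  simp only [Set.mem_insert_iff, Set.mem_singleton_iff] at hg
  rcases hg with rfl | rfl <;> simp [hj0.symm, hji.symm]

/-- a coordinate off a coordinate triple is not in the ideal the triple spans. [elementary] [folklore] -/
theorem X_not_mem_span_triple {i i' j : Fin 4} (hj0 : j ≠ 0) (hji : j ≠ i) (hji' : j ≠ i') :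
    (X j : MvPolynomial (Fin 4) K) ∉ Ideal.span {(X 0 : MvPolynomial (Fin 4) K), X i, X i'} := by
  refine not_mem_span_of_eval _ (fun l => if l = j then 1 else 0) ?_ (by simp)
  intro g hg
  simp only [Set.mem_insert_iff, Set.mem_singleton_iff] at hg
  rcases hg with rfl | rfl | rfl <;> simp [hj0.symm, hji.symm, hji'.symm]

/-- **T₃ — SYMMETRY**: the coordinate swaps `t ↔ u` and `t ↔ w` fix `T₃` (so every statement below about the plane `P_t` /
the axis `A_t` holds for `P_u, P_w` / `A_u, A_w`). [new; elementary] [folklore] -/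
theorem T3_symm :
    rename (Equiv.swap 1 2) (X 0 ^ 3 + (X 1 * X 2 * X 3) ^ 4 : MvPolynomial (Fin 4) K) = X 0 ^ 3 + (X 1 * X 2 * X 3) ^ 4 ∧
      rename (Equiv.swap 1 3) (X 0 ^ 3 + (X 1 * X 2 * X 3) ^ 4 : MvPolynomial (Fin 4) K) =
        X 0 ^ 3 + (X 1 * X 2 * X 3) ^ 4 := by
  constructor <;> (simp [rename_X, Equiv.swap_apply_def]; ring)

/-- **T₃ — (T) THE TOP LOCUS lies in `P_t ∪ P_u ∪ P_w = V(z, tuw)`** (characteristic `3`): a prime `𝔮` with `ord_𝔮(T₃) ≥ 3`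
contains `z` and one of `t, u, w` (`∂_t T₃ = 4·uw·(tuw)³` forces `tuw ∈ 𝔮`, then `z³ = T₃ − (tuw)⁴ ∈ 𝔮`). [new; elementary]
[folklore] -/
theorem T3_top [CharP K 3] (𝔮 : Ideal (MvPolynomial (Fin 4) K)) [𝔮.IsPrime] {s : MvPolynomial (Fin 4) K} (hs : s ∉ 𝔮)
    (h : s * (X 0 ^ 3 + (X 1 * X 2 * X 3) ^ 4 : MvPolynomial (Fin 4) K) ∈ 𝔮 ^ 3) :
    (X 0 : MvPolynomial (Fin 4) K) ∈ 𝔮 ∧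
      ((X 1 : MvPolynomial (Fin 4) K) ∈ 𝔮 ∨ (X 2 : MvPolynomial (Fin 4) K) ∈ 𝔮 ∨ (X 3 : MvPolynomial (Fin 4) K) ∈ 𝔮) := by
  have hP := ‹𝔮.IsPrime›
  have hs2 : s ^ 2 ∉ 𝔮 := pow_not_mem 𝔮 hs 2
  have h4 : (4 : MvPolynomial (Fin 4) K) ∉ 𝔮 := by
    have := natCast_not_mem (K := K) 𝔮 (m := 4) (by decide)
    exact_mod_cast this
  have e10 := f_ne K (i := 1) (j := 0) (by decide)
  have e11 := f_self K 1
  have e12 := f_ne K (i := 1) (j := 2) (by decide)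
  have e13 := f_ne K (i := 1) (j := 3) (by decide)
  have d1 : pderiv 1 (X 0 ^ 3 + (X 1 * X 2 * X 3) ^ 4 : MvPolynomial (Fin 4) K) =
      4 * (X 2 * X 3 * (X 1 * X 2 * X 3) ^ 3) ^ 1 := by
    simp only [map_add, Derivation.leibniz, Derivation.leibniz_pow, smul_eq_mul, nsmul_eq_mul, e10, e11, e12, e13]
    push_cast; ring
  have h11 := sq_mul_deriv_mem_pow 𝔮 h (pderiv 1)
  rw [d1] at h11
  have hA : (X 2 * X 3 * (X 1 * X 2 * X 3) ^ 3 : MvPolynomial (Fin 4) K) ∈ 𝔮 :=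
    mem_of_mul_mul_pow_mem_pow 𝔮 two_ne_zero hs2 h4 h11
  have hm : (X 1 * X 2 * X 3 : MvPolynomial (Fin 4) K) ∈ 𝔮 := by
    rcases hP.mem_or_mem hA with h23 | h123
    · rcases hP.mem_or_mem h23 with h2 | h3
      · exact Ideal.mul_mem_right _ _ (Ideal.mul_mem_left _ _ h2)
      · exact Ideal.mul_mem_left _ _ h3
    · exact hP.mem_of_pow_mem 3 h123
  have hf : (X 0 ^ 3 + (X 1 * X 2 * X 3) ^ 4 : MvPolynomial (Fin 4) K) ∈ 𝔮 := mem_of_sMul_mem_cube 𝔮 hs h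
  have h0 : (X 0 : MvPolynomial (Fin 4) K) ^ 3 ∈ 𝔮 := by
    have := Ideal.sub_mem _ hf (Ideal.pow_mem_of_mem 𝔮 hm 4 (by norm_num))
    rwa [add_sub_cancel_right] at this
  refine ⟨hP.mem_of_pow_mem 3 h0, ?_⟩
  rcases hP.mem_or_mem hm with h12 | h3
  · rcases hP.mem_or_mem h12 with h1 | h2
    · exact Or.inl h1
    · exact Or.inr (Or.inl h2)
  · exact Or.inr (Or.inr h3)

/-- **T₃ — (W) EACH COORDINATE PLANE `P_x = V(z, x)` (`x ∈ {t,u,w}`) LIES IN THE TOP LOCUS AND THE DATUM IS WILD ALONG IT**: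
`(tuw)⁴ ∈ (z,x)⁴` and `T₃ = z³ + (tuw)⁴ ∈ (z,x)³` — at every point of `P_x` the datum is `z³ + (𝔪⁴)`, a `3`-power form.
[new; elementary] [folklore] -/
theorem T3_wild_plane {i : Fin 4} (hi : i = 1 ∨ i = 2 ∨ i = 3) :
    ((X 1 * X 2 * X 3) ^ 4 : MvPolynomial (Fin 4) K) ∈ (Ideal.span {(X 0 : MvPolynomial (Fin 4) K), X i}) ^ 4 ∧
      (X 0 ^ 3 + (X 1 * X 2 * X 3) ^ 4 : MvPolynomial (Fin 4) K) ∈ (Ideal.span {(X 0 : MvPolynomial (Fin 4) K), X i}) ^ 3 := by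
  have a0 : (X 0 : MvPolynomial (Fin 4) K) ∈ Ideal.span {(X 0 : MvPolynomial (Fin 4) K), X i} := Ideal.subset_span (by simp)
  have ai : (X i : MvPolynomial (Fin 4) K) ∈ Ideal.span {(X 0 : MvPolynomial (Fin 4) K), X i} := Ideal.subset_span (by simp)
  have hm : (X 1 * X 2 * X 3 : MvPolynomial (Fin 4) K) ∈ Ideal.span {(X 0 : MvPolynomial (Fin 4) K), X i} := by
    rcases hi with rfl | rfl | rfl
    · exact Ideal.mul_mem_right _ _ (Ideal.mul_mem_right _ _ ai)
    · exact Ideal.mul_mem_right _ _ (Ideal.mul_mem_left _ _ ai)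
    · exact Ideal.mul_mem_left _ _ ai
  have h4 := Ideal.pow_mem_pow hm 4
  exact ⟨h4, Ideal.add_mem _ (Ideal.pow_mem_pow a0 3) (Ideal.pow_le_pow_right (by norm_num) h4)⟩

/-- **T₃ — the three planes ARE planes** (`u, w ∉ (z,t)`, `t, w ∉ (z,u)`, `t, u ∉ (z,w)`); in particular the closure of the bad
locus is NOT a curve. [new; elementary] [folklore] -/
theorem T3_planes :
    ((X 2 : MvPolynomial (Fin 4) K) ∉ Ideal.span {(X 0 : MvPolynomial (Fin 4) K), X 1} ∧
        (X 3 : MvPolynomial (Fin 4) K) ∉ Ideal.span {(X 0 : MvPolynomial (Fin 4) K), X 1}) ∧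
      ((X 1 : MvPolynomial (Fin 4) K) ∉ Ideal.span {(X 0 : MvPolynomial (Fin 4) K), X 2} ∧
        (X 3 : MvPolynomial (Fin 4) K) ∉ Ideal.span {(X 0 : MvPolynomial (Fin 4) K), X 2}) ∧
      ((X 1 : MvPolynomial (Fin 4) K) ∉ Ideal.span {(X 0 : MvPolynomial (Fin 4) K), X 3} ∧
        (X 2 : MvPolynomial (Fin 4) K) ∉ Ideal.span {(X 0 : MvPolynomial (Fin 4) K), X 3}) :=
  ⟨⟨X_not_mem_span_pair (by decide) (by decide), X_not_mem_span_pair (by decide) (by decide)⟩,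
    ⟨X_not_mem_span_pair (by decide) (by decide), X_not_mem_span_pair (by decide) (by decide)⟩,
    ⟨X_not_mem_span_pair (by decide) (by decide), X_not_mem_span_pair (by decide) (by decide)⟩⟩

/-- **T₃ — (E)+(N) EVERY CLOSED POINT `c = (0,0,a,b)` OF `P_t` HAS A NEAR POINT** (and, by `T3_symm`, every closed point of
`P_u`, `P_w`): translated to `c` the datum is `z³ + (t·(u+a)·(w+b))⁴`; chart `u` of the point blow-up at `c` (`z ↦ z·u, t ↦
t·u, w ↦ w·u`) gives `u³ · (z'³ + u·t'⁴·Φ)`, `Φ = ((u+a)(u·w'+b))⁴`, and `z'³ + u·t'⁴·Φ ∈ 𝔫'³` for EVERY cofactor `Φ`: the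
chart origin is a NEAR point.  So every closed point of `P_t ∪ P_u ∪ P_w` is a bad point WITH a near point (δ-heavy):
bad₀ = all closed points of the three planes, closure bad₀ `= Σ = P_t ∪ P_u ∪ P_w`, NONEMPTY. [new; elementary] [folklore] -/
theorem T3_near (a b : K) :
    aeval (fun j : Fin 4 => if j = 2 then (X 2 + C a : MvPolynomial (Fin 4) K) else if j = 3 then X 3 + C b else X j)
        (X 0 ^ 3 + (X 1 * X 2 * X 3) ^ 4 : MvPolynomial (Fin 4) K) = X 0 ^ 3 + (X 1 * (X 2 + C a) * (X 3 + C b)) ^ 4 ∧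
      aeval (chartSubst (K := K) 2) (X 0 ^ 3 + (X 1 * (X 2 + C a) * (X 3 + C b)) ^ 4 : MvPolynomial (Fin 4) K) =
        X 2 ^ 3 * (X 0 ^ 3 + X 2 * X 1 ^ 4 * ((X 2 + C a) * (X 2 * X 3 + C b)) ^ 4) ∧
      ∀ Φ : MvPolynomial (Fin 4) K, (X 0 ^ 3 + X 2 * X 1 ^ 4 * Φ : MvPolynomial (Fin 4) K) ∈
        (Ideal.span {(X 0 : MvPolynomial (Fin 4) K), X 1, X 2, X 3}) ^ 3 := by
  refine ⟨?_, ?_, fun Φ => ?_⟩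
  · simp only [map_add, map_mul, map_pow, aeval_X, Fin.isValue, if_true, show (0 : Fin 4) ≠ 2 by decide,
      show (0 : Fin 4) ≠ 3 by decide, show (1 : Fin 4) ≠ 2 by decide, show (1 : Fin 4) ≠ 3 by decide,
      show (3 : Fin 4) ≠ 2 by decide, if_false]
  · simp [chartSubst]; ring
  · refine Ideal.add_mem _ (Ideal.pow_mem_pow (X_mem_spanX4 0) 3) (Ideal.mul_mem_right Φ _ ?_)
    exact Ideal.mul_mem_left _ (X 2) (Ideal.pow_le_pow_right (by norm_num) (Ideal.pow_mem_pow (X_mem_spanX4 1) 4))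

/-- **T₃ — (R′) THE REDUCED CLOSURE `Σ = V(𝓘(P_t) ∩ 𝓘(P_u) ∩ 𝓘(P_w))` OF bad₀ IS NOT REGULAR at the origin** (nor at any point
of a coordinate axis of `V(z)`): `t·(u·w) ∈ J` while `t, u·w ∉ J` — the local ring of `Σ` there is not a domain.  `Σ` is its
own SURFACE PART (all three components are planes): `¬ ClosureRegular`, `¬ SurfaceRegular`; with `T3_planes`: `¬ DimLEOne`.
[new; elementary] [folklore] -/
theorem T3_closure_not_prime :
    (X 1 * (X 2 * X 3) : MvPolynomial (Fin 4) K) ∈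
        Ideal.span {(X 0 : MvPolynomial (Fin 4) K), X 1} ⊓ Ideal.span {(X 0 : MvPolynomial (Fin 4) K), X 2} ⊓
          Ideal.span {(X 0 : MvPolynomial (Fin 4) K), X 3} ∧
      (X 1 : MvPolynomial (Fin 4) K) ∉
        Ideal.span {(X 0 : MvPolynomial (Fin 4) K), X 1} ⊓ Ideal.span {(X 0 : MvPolynomial (Fin 4) K), X 2} ⊓
          Ideal.span {(X 0 : MvPolynomial (Fin 4) K), X 3} ∧
      (X 2 * X 3 : MvPolynomial (Fin 4) K) ∉
        Ideal.span {(X 0 : MvPolynomial (Fin 4) K), X 1} ⊓ Ideal.span {(X 0 : MvPolynomial (Fin 4) K), X 2} ⊓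
          Ideal.span {(X 0 : MvPolynomial (Fin 4) K), X 3} := by
  have a1 : (X 1 : MvPolynomial (Fin 4) K) ∈ Ideal.span {(X 0 : MvPolynomial (Fin 4) K), X 1} := Ideal.subset_span (by simp)
  have b2 : (X 2 : MvPolynomial (Fin 4) K) ∈ Ideal.span {(X 0 : MvPolynomial (Fin 4) K), X 2} := Ideal.subset_span (by simp)
  have c3 : (X 3 : MvPolynomial (Fin 4) K) ∈ Ideal.span {(X 0 : MvPolynomial (Fin 4) K), X 3} := Ideal.subset_span (by simp)
  refine ⟨Ideal.mem_inf.2 ⟨Ideal.mem_inf.2 ⟨Ideal.mul_mem_right _ _ a1, Ideal.mul_mem_left _ _ (Ideal.mul_mem_right _ _ b2)⟩,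
    Ideal.mul_mem_left _ _ (Ideal.mul_mem_left _ _ c3)⟩, fun h1 => ?_, fun h23 => ?_⟩
  · exact X_not_mem_span_pair (K := K) (i := 2) (j := 1) (by decide) (by decide) (Ideal.mem_inf.1 (Ideal.mem_inf.1 h1).1).2
  · refine not_mem_span_of_eval _ (fun i => if i = 2 ∨ i = 3 then 1 else 0) ?_ (by simp)
      (Ideal.mem_inf.1 (Ideal.mem_inf.1 h23).1).1
    intro g hg
    simp only [Set.mem_insert_iff, Set.mem_singleton_iff] at hg
    rcases hg with rfl | rfl <;> simp

/-- **T₃ — (S′) `Sing(Σ_red)` IS THE UNION OF THE THREE COORDINATE AXES `A_t = V(z,u,w)`, `A_u = V(z,t,w)`, `A_w = V(z,t,u)`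
of `V(z)`.**  `Σ = V(z, tuw)` is a complete intersection whose second equation lies in `(u,w)² ∩ (t,w)² ∩ (t,u)²`: SINGULAR at
every point of each axis ((R″); first three conjuncts); and `(z, uw·t) ⊆ J ⊆ (z,t)`, `(z, tw·u) ⊆ J ⊆ (z,u)`, `(z, tu·w) ⊆ J
⊆ (z,w)` (`J = 𝓘(Σ)` as in `T3_closure_not_prime`): on `D(uw)`, `D(tw)`, `D(tu)` — off the three axes — `Σ` is a coordinate
PLANE, REGULAR (R).  So `Sing(Σ_red) = A_t ∪ A_u ∪ A_w`, closed, through the origin. [new; elementary] [folklore] -/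
theorem T3_sing_axes :
    ((X 1 * X 2 * X 3 : MvPolynomial (Fin 4) K) ∈ (Ideal.span {(X 2 : MvPolynomial (Fin 4) K), X 3}) ^ 2 ∧
      (X 1 * X 2 * X 3 : MvPolynomial (Fin 4) K) ∈ (Ideal.span {(X 1 : MvPolynomial (Fin 4) K), X 3}) ^ 2 ∧
      (X 1 * X 2 * X 3 : MvPolynomial (Fin 4) K) ∈ (Ideal.span {(X 1 : MvPolynomial (Fin 4) K), X 2}) ^ 2) ∧
    (Ideal.span {(X 0 : MvPolynomial (Fin 4) K), X 2 * X 3 * X 1} ≤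
        Ideal.span {(X 0 : MvPolynomial (Fin 4) K), X 1} ⊓ Ideal.span {(X 0 : MvPolynomial (Fin 4) K), X 2} ⊓
          Ideal.span {(X 0 : MvPolynomial (Fin 4) K), X 3} ∧
      Ideal.span {(X 0 : MvPolynomial (Fin 4) K), X 1} ⊓ Ideal.span {(X 0 : MvPolynomial (Fin 4) K), X 2} ⊓
          Ideal.span {(X 0 : MvPolynomial (Fin 4) K), X 3} ≤ Ideal.span {(X 0 : MvPolynomial (Fin 4) K), X 1}) ∧
    (Ideal.span {(X 0 : MvPolynomial (Fin 4) K), X 1 * X 3 * X 2} ≤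
        Ideal.span {(X 0 : MvPolynomial (Fin 4) K), X 1} ⊓ Ideal.span {(X 0 : MvPolynomial (Fin 4) K), X 2} ⊓
          Ideal.span {(X 0 : MvPolynomial (Fin 4) K), X 3} ∧
      Ideal.span {(X 0 : MvPolynomial (Fin 4) K), X 1} ⊓ Ideal.span {(X 0 : MvPolynomial (Fin 4) K), X 2} ⊓
          Ideal.span {(X 0 : MvPolynomial (Fin 4) K), X 3} ≤ Ideal.span {(X 0 : MvPolynomial (Fin 4) K), X 2}) ∧
    (Ideal.span {(X 0 : MvPolynomial (Fin 4) K), X 1 * X 2 * X 3} ≤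
        Ideal.span {(X 0 : MvPolynomial (Fin 4) K), X 1} ⊓ Ideal.span {(X 0 : MvPolynomial (Fin 4) K), X 2} ⊓
          Ideal.span {(X 0 : MvPolynomial (Fin 4) K), X 3} ∧
      Ideal.span {(X 0 : MvPolynomial (Fin 4) K), X 1} ⊓ Ideal.span {(X 0 : MvPolynomial (Fin 4) K), X 2} ⊓
          Ideal.span {(X 0 : MvPolynomial (Fin 4) K), X 3} ≤ Ideal.span {(X 0 : MvPolynomial (Fin 4) K), X 3}) := by
  have a0 : (X 0 : MvPolynomial (Fin 4) K) ∈ Ideal.span {(X 0 : MvPolynomial (Fin 4) K), X 1} := Ideal.subset_span (by simp)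
  have a1 : (X 1 : MvPolynomial (Fin 4) K) ∈ Ideal.span {(X 0 : MvPolynomial (Fin 4) K), X 1} := Ideal.subset_span (by simp)
  have b0 : (X 0 : MvPolynomial (Fin 4) K) ∈ Ideal.span {(X 0 : MvPolynomial (Fin 4) K), X 2} := Ideal.subset_span (by simp)
  have b2 : (X 2 : MvPolynomial (Fin 4) K) ∈ Ideal.span {(X 0 : MvPolynomial (Fin 4) K), X 2} := Ideal.subset_span (by simp)
  have c0 : (X 0 : MvPolynomial (Fin 4) K) ∈ Ideal.span {(X 0 : MvPolynomial (Fin 4) K), X 3} := Ideal.subset_span (by simp)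
  have c3 : (X 3 : MvPolynomial (Fin 4) K) ∈ Ideal.span {(X 0 : MvPolynomial (Fin 4) K), X 3} := Ideal.subset_span (by simp)
  have p2 : (X 2 : MvPolynomial (Fin 4) K) ∈ Ideal.span {(X 2 : MvPolynomial (Fin 4) K), X 3} := Ideal.subset_span (by simp)
  have p3 : (X 3 : MvPolynomial (Fin 4) K) ∈ Ideal.span {(X 2 : MvPolynomial (Fin 4) K), X 3} := Ideal.subset_span (by simp)
  have q1 : (X 1 : MvPolynomial (Fin 4) K) ∈ Ideal.span {(X 1 : MvPolynomial (Fin 4) K), X 3} := Ideal.subset_span (by simp)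
  have q3 : (X 3 : MvPolynomial (Fin 4) K) ∈ Ideal.span {(X 1 : MvPolynomial (Fin 4) K), X 3} := Ideal.subset_span (by simp)
  have r1 : (X 1 : MvPolynomial (Fin 4) K) ∈ Ideal.span {(X 1 : MvPolynomial (Fin 4) K), X 2} := Ideal.subset_span (by simp)
  have r2 : (X 2 : MvPolynomial (Fin 4) K) ∈ Ideal.span {(X 1 : MvPolynomial (Fin 4) K), X 2} := Ideal.subset_span (by simp)
  -- the product tuw lies in J (all three orderings used below)
  have hJ : ∀ m : MvPolynomial (Fin 4) K, m = X 1 * X 2 * X 3 →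
      m ∈ Ideal.span {(X 0 : MvPolynomial (Fin 4) K), X 1} ⊓ Ideal.span {(X 0 : MvPolynomial (Fin 4) K), X 2} ⊓
        Ideal.span {(X 0 : MvPolynomial (Fin 4) K), X 3} := by
    rintro m rfl
    exact Ideal.mem_inf.2 ⟨Ideal.mem_inf.2 ⟨Ideal.mul_mem_right _ _ (Ideal.mul_mem_right _ _ a1),
      Ideal.mul_mem_right _ _ (Ideal.mul_mem_left _ _ b2)⟩, Ideal.mul_mem_left _ _ c3⟩
  have hz : (X 0 : MvPolynomial (Fin 4) K) ∈ Ideal.span {(X 0 : MvPolynomial (Fin 4) K), X 1} ⊓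
      Ideal.span {(X 0 : MvPolynomial (Fin 4) K), X 2} ⊓ Ideal.span {(X 0 : MvPolynomial (Fin 4) K), X 3} :=
    Ideal.mem_inf.2 ⟨Ideal.mem_inf.2 ⟨a0, b0⟩, c0⟩
  have spanle : ∀ m : MvPolynomial (Fin 4) K, m = X 1 * X 2 * X 3 →
      Ideal.span {(X 0 : MvPolynomial (Fin 4) K), m} ≤ Ideal.span {(X 0 : MvPolynomial (Fin 4) K), X 1} ⊓
        Ideal.span {(X 0 : MvPolynomial (Fin 4) K), X 2} ⊓ Ideal.span {(X 0 : MvPolynomial (Fin 4) K), X 3} := by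
    intro m hm
    subst hm
    refine Ideal.span_le.2 ?_
    rintro g hg
    simp only [Set.mem_insert_iff, Set.mem_singleton_iff] at hg
    rcases hg with rfl | rfl
    · exact hz
    · exact hJ _ rfl
  refine ⟨⟨?_, ?_, ?_⟩, ⟨spanle _ (by ring), inf_le_left.trans inf_le_left⟩, ⟨spanle _ (by ring), inf_le_left.trans inf_le_right⟩,
    ⟨spanle _ rfl, inf_le_right⟩⟩
  · rw [pow_two]; exact Ideal.mul_mem_mul (Ideal.mul_mem_left _ _ p2) p3
  · rw [pow_two]; exact Ideal.mul_mem_mul (Ideal.mul_mem_right _ _ q1) q3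
  · rw [pow_two]; exact Ideal.mul_mem_right _ _ (Ideal.mul_mem_mul r1 r2)

/-- **T₃ — (S′) THE REDUCED CLOSURE OF `Sing(Σ_red)` — the three concurrent axes, ideal `I_A = 𝓘(A_t) ∩ 𝓘(A_u) ∩ 𝓘(A_w)` — IS
NOT REGULAR at the origin**: `t·u ∈ I_A`, `t ∉ I_A`, `u ∉ I_A` (its local ring at `𝔫₀ ⊇ I_A` is not a domain); it passes
through the origin (`I_A ⊆ 𝔫₀`), so it is NONEMPTY.  THE g30 TEST `SingRegular` FAILS. [new; elementary] [folklore] -/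
theorem T3_singClosure_not_prime :
    (X 1 * X 2 : MvPolynomial (Fin 4) K) ∈
        Ideal.span {(X 0 : MvPolynomial (Fin 4) K), X 2, X 3} ⊓ Ideal.span {(X 0 : MvPolynomial (Fin 4) K), X 1, X 3} ⊓
          Ideal.span {(X 0 : MvPolynomial (Fin 4) K), X 1, X 2} ∧
      (X 1 : MvPolynomial (Fin 4) K) ∉
        Ideal.span {(X 0 : MvPolynomial (Fin 4) K), X 2, X 3} ⊓ Ideal.span {(X 0 : MvPolynomial (Fin 4) K), X 1, X 3} ⊓
          Ideal.span {(X 0 : MvPolynomial (Fin 4) K), X 1, X 2} ∧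
      (X 2 : MvPolynomial (Fin 4) K) ∉
        Ideal.span {(X 0 : MvPolynomial (Fin 4) K), X 2, X 3} ⊓ Ideal.span {(X 0 : MvPolynomial (Fin 4) K), X 1, X 3} ⊓
          Ideal.span {(X 0 : MvPolynomial (Fin 4) K), X 1, X 2} ∧
      Ideal.span {(X 0 : MvPolynomial (Fin 4) K), X 2, X 3} ⊓ Ideal.span {(X 0 : MvPolynomial (Fin 4) K), X 1, X 3} ⊓
          Ideal.span {(X 0 : MvPolynomial (Fin 4) K), X 1, X 2} ≤
        Ideal.span {(X 0 : MvPolynomial (Fin 4) K), X 1, X 2, X 3} := by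
  have a2 : (X 2 : MvPolynomial (Fin 4) K) ∈ Ideal.span {(X 0 : MvPolynomial (Fin 4) K), X 2, X 3} := Ideal.subset_span (by simp)
  have b1 : (X 1 : MvPolynomial (Fin 4) K) ∈ Ideal.span {(X 0 : MvPolynomial (Fin 4) K), X 1, X 3} := Ideal.subset_span (by simp)
  have c1 : (X 1 : MvPolynomial (Fin 4) K) ∈ Ideal.span {(X 0 : MvPolynomial (Fin 4) K), X 1, X 2} := Ideal.subset_span (by simp)
  refine ⟨Ideal.mem_inf.2 ⟨Ideal.mem_inf.2 ⟨Ideal.mul_mem_left _ _ a2, Ideal.mul_mem_right _ _ b1⟩, Ideal.mul_mem_right _ _ c1⟩,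
    fun h1 => ?_, fun h2 => ?_, ?_⟩
  · exact X_not_mem_span_triple (K := K) (i := 2) (i' := 3) (j := 1) (by decide) (by decide) (by decide)
      (Ideal.mem_inf.1 (Ideal.mem_inf.1 h1).1).1
  · exact X_not_mem_span_triple (K := K) (i := 1) (i' := 3) (j := 2) (by decide) (by decide) (by decide)
      (Ideal.mem_inf.1 (Ideal.mem_inf.1 h2).1).2
  · refine inf_le_right.trans (Ideal.span_mono ?_)
    intro x hx
    simp only [Set.mem_insert_iff, Set.mem_singleton_iff] at hx ⊢
    rcases hx with rfl | rfl | rfl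
    · exact Or.inl rfl
    · exact Or.inr (Or.inl rfl)
    · exact Or.inr (Or.inr (Or.inl rfl))

/-- **T₃ — THE F-ss² CERTIFICATE (`SFrozen 3 ⟨(𝔸⁴, (T₃)), none⟩` at s-height `0`; THE LOCATED RESIDUAL KIND F-ss² OF THE
SINGULAR CUT IS INHABITED).**  (T) top `⊆ P_t ∪ P_u ∪ P_w` (`T3_top`); (W) the three planes lie in the top locus, WILD
(`T3_wild_plane`), and are planes (`T3_planes`: not a curve); (N) every closed point of each plane has a NEAR point
(`T3_near`, `T3_symm`): bad₀ = all closed points of `Σ = P_t ∪ P_u ∪ P_w`, closure `= Σ`, NONEMPTY; (R′) `Σ` — its own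
surface part — is NOT regular (`T3_closure_not_prime`); (S′) `Sing(Σ_red)` = the three coordinate axes of `V(z)`
(`T3_sing_axes`) and their reduced closure is NOT regular at the origin (`T3_singClosure_not_prime`).  Nothing pending, bad
`≠ ∅`, `¬ ClosureRegular`, `¬ DimLEOne`, `¬ SurfaceRegular`, `¬ SingRegular`: by `SingCut.sStuck_iff_singSing` the singular run
is STUCK at level `0` — `SFrozen` with the empty moving prefix. [new] [folklore] -/
theorem T3_sFrozen_certificate [CharP K 3] :
    -- symmetry
    (rename (Equiv.swap 1 2) (X 0 ^ 3 + (X 1 * X 2 * X 3) ^ 4 : MvPolynomial (Fin 4) K) = X 0 ^ 3 + (X 1 * X 2 * X 3) ^ 4 ∧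
      rename (Equiv.swap 1 3) (X 0 ^ 3 + (X 1 * X 2 * X 3) ^ 4 : MvPolynomial (Fin 4) K) =
        X 0 ^ 3 + (X 1 * X 2 * X 3) ^ 4) ∧
    -- (T)
    (∀ (𝔮 : Ideal (MvPolynomial (Fin 4) K)) [𝔮.IsPrime], ∀ s ∉ 𝔮,
        s * (X 0 ^ 3 + (X 1 * X 2 * X 3) ^ 4 : MvPolynomial (Fin 4) K) ∈ 𝔮 ^ 3 →
          (X 0 : MvPolynomial (Fin 4) K) ∈ 𝔮 ∧
            ((X 1 : MvPolynomial (Fin 4) K) ∈ 𝔮 ∨ (X 2 : MvPolynomial (Fin 4) K) ∈ 𝔮 ∨ (X 3 : MvPolynomial (Fin 4) K) ∈ 𝔮)) ∧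
    -- (W) along P_t (P_u, P_w by symmetry)
    (((X 1 * X 2 * X 3) ^ 4 : MvPolynomial (Fin 4) K) ∈ (Ideal.span {(X 0 : MvPolynomial (Fin 4) K), X 1}) ^ 4 ∧
      (X 0 ^ 3 + (X 1 * X 2 * X 3) ^ 4 : MvPolynomial (Fin 4) K) ∈ (Ideal.span {(X 0 : MvPolynomial (Fin 4) K), X 1}) ^ 3) ∧
    ((X 2 : MvPolynomial (Fin 4) K) ∉ Ideal.span {(X 0 : MvPolynomial (Fin 4) K), X 1} ∧
      (X 3 : MvPolynomial (Fin 4) K) ∉ Ideal.span {(X 0 : MvPolynomial (Fin 4) K), X 1}) ∧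
    -- (N)
    (∀ a b : K, aeval (chartSubst (K := K) 2) (X 0 ^ 3 + (X 1 * (X 2 + C a) * (X 3 + C b)) ^ 4 : MvPolynomial (Fin 4) K) =
        X 2 ^ 3 * (X 0 ^ 3 + X 2 * X 1 ^ 4 * ((X 2 + C a) * (X 2 * X 3 + C b)) ^ 4)) ∧
    (∀ Φ : MvPolynomial (Fin 4) K, (X 0 ^ 3 + X 2 * X 1 ^ 4 * Φ : MvPolynomial (Fin 4) K) ∈
        (Ideal.span {(X 0 : MvPolynomial (Fin 4) K), X 1, X 2, X 3}) ^ 3) ∧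
    -- (R′)
    ((X 1 * (X 2 * X 3) : MvPolynomial (Fin 4) K) ∈
        Ideal.span {(X 0 : MvPolynomial (Fin 4) K), X 1} ⊓ Ideal.span {(X 0 : MvPolynomial (Fin 4) K), X 2} ⊓
          Ideal.span {(X 0 : MvPolynomial (Fin 4) K), X 3} ∧
      (X 1 : MvPolynomial (Fin 4) K) ∉
        Ideal.span {(X 0 : MvPolynomial (Fin 4) K), X 1} ⊓ Ideal.span {(X 0 : MvPolynomial (Fin 4) K), X 2} ⊓
          Ideal.span {(X 0 : MvPolynomial (Fin 4) K), X 3} ∧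
      (X 2 * X 3 : MvPolynomial (Fin 4) K) ∉
        Ideal.span {(X 0 : MvPolynomial (Fin 4) K), X 1} ⊓ Ideal.span {(X 0 : MvPolynomial (Fin 4) K), X 2} ⊓
          Ideal.span {(X 0 : MvPolynomial (Fin 4) K), X 3}) ∧
    -- (S′) Sing(Σ_red) ⊇ the three axes …
    ((X 1 * X 2 * X 3 : MvPolynomial (Fin 4) K) ∈ (Ideal.span {(X 2 : MvPolynomial (Fin 4) K), X 3}) ^ 2 ∧
      (X 1 * X 2 * X 3 : MvPolynomial (Fin 4) K) ∈ (Ideal.span {(X 1 : MvPolynomial (Fin 4) K), X 3}) ^ 2 ∧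
      (X 1 * X 2 * X 3 : MvPolynomial (Fin 4) K) ∈ (Ideal.span {(X 1 : MvPolynomial (Fin 4) K), X 2}) ^ 2) ∧
    -- … = the three axes (Σ is a coordinate plane on D(uw)) …
    (Ideal.span {(X 0 : MvPolynomial (Fin 4) K), X 2 * X 3 * X 1} ≤
        Ideal.span {(X 0 : MvPolynomial (Fin 4) K), X 1} ⊓ Ideal.span {(X 0 : MvPolynomial (Fin 4) K), X 2} ⊓
          Ideal.span {(X 0 : MvPolynomial (Fin 4) K), X 3} ∧
      Ideal.span {(X 0 : MvPolynomial (Fin 4) K), X 1} ⊓ Ideal.span {(X 0 : MvPolynomial (Fin 4) K), X 2} ⊓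
          Ideal.span {(X 0 : MvPolynomial (Fin 4) K), X 3} ≤ Ideal.span {(X 0 : MvPolynomial (Fin 4) K), X 1}) ∧
    -- … whose reduced closure is NOT regular at the origin
    ((X 1 * X 2 : MvPolynomial (Fin 4) K) ∈
        Ideal.span {(X 0 : MvPolynomial (Fin 4) K), X 2, X 3} ⊓ Ideal.span {(X 0 : MvPolynomial (Fin 4) K), X 1, X 3} ⊓
          Ideal.span {(X 0 : MvPolynomial (Fin 4) K), X 1, X 2} ∧
      (X 1 : MvPolynomial (Fin 4) K) ∉
        Ideal.span {(X 0 : MvPolynomial (Fin 4) K), X 2, X 3} ⊓ Ideal.span {(X 0 : MvPolynomial (Fin 4) K), X 1, X 3} ⊓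
          Ideal.span {(X 0 : MvPolynomial (Fin 4) K), X 1, X 2} ∧
      (X 2 : MvPolynomial (Fin 4) K) ∉
        Ideal.span {(X 0 : MvPolynomial (Fin 4) K), X 2, X 3} ⊓ Ideal.span {(X 0 : MvPolynomial (Fin 4) K), X 1, X 3} ⊓
          Ideal.span {(X 0 : MvPolynomial (Fin 4) K), X 1, X 2}) :=
  ⟨T3_symm, fun 𝔮 _ _ hs h => T3_top 𝔮 hs h, T3_wild_plane (Or.inl rfl), T3_planes.1, fun a b => (T3_near a b).2.1,
    fun Φ => (T3_near (0 : K) 0).2.2 Φ, T3_closure_not_prime, T3_sing_axes.1, T3_sing_axes.2.1,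
    ⟨T3_singClosure_not_prime.1, T3_singClosure_not_prime.2.1, T3_singClosure_not_prime.2.2.1⟩⟩

end SCertificatesA

end Summit.ResolutionOfSingularities.ResolutionOfSingularities.Theorems.DeltaCutClasses
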